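import Mathlib
import HarnessLib
import HarnessLib.Audit.Tags

/-!
# `NoHeavyLowerTail` (crux stmt-CriticalPhenomena-4575), master-family line P1 (gen 18):
# two cells are negatively correlated GIVEN THAT THEIR UNION LIES IN A COMMON SUPER-UP-SET (Ahlswede–Daykin)

Support file (seat `prim-masterthm-p1`, gen 18; `--supports stmt-CriticalPhenomena-4575`).
Memo `run/shared/lean/prim/prim-masterthm/FROM-prim-masterthm-p1-g18-UNION-CONDITIONED.md` §1.

SETTING.  `ι` a finite ground set; an ORDERED PAIR OF CELLS `(x, y)` (two of the three cells of an ordered tripartition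
`(x, y, z)`; for the twisted = UNATE model the cells of `t`-coordinates are doubly covered).  Which pairs are admissible
is a Boolean test `T x y`; the only property we need is that `T` is LATTICE-CLOSED: preserved by the two operations
`(x ∪ x', y ∩ y')` and `(x ∩ x', y ∪ y')` of the distributive lattice `2^ι × (2^ι)ᵒᵈ` (`x` ordered upwards, `y` downwards).
Examples (`twoCover_latticeClosed`): `T_t x y = [x ∩ y ⊆ t ⊆ x ∪ y]` — for `t = ∅` the DISJOINT pairs = ordered
tripartitions `(x, y, (x ∪ y)ᶜ)` (the tree's `SahiTripartition.triCount` model), for general `t` the cells of the unate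
property `u (· △ t)` (gen 17's `UnateTripartitionULC`: coordinates in `t` lie in exactly two of the three cells).

* **THEOREM (`pairCount_unionCond_mul_le`).**  For a lattice-closed `T` and monotone Boolean `u, u' ≤ a` (three up-sets,
  the first two inside the third):
  `#{x ∈ u, y ∈ u', x ∪ y ∈ a} · #{x ∪ y ∈ a} ≤ #{x ∈ u, x ∪ y ∈ a} · #{y ∈ u', x ∪ y ∈ a}`,
  i.e. for a uniform admissible pair CONDITIONED ON `x ∪ y ∈ a` the events `x ∈ u`, `y ∈ u'` are negatively correlated.
  In tripartition language (`t = ∅`): conditioned on `Z ∈ C` for the DOWN-set `C = {Z : Zᶜ ∈ a}`, `X ∈ U` and `Y ∈ U'` are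
  negatively correlated whenever `U, U' ⊆ a`.  Proof: the four functions theorem (Mathlib `four_functions_theorem_univ`)
  on `2^ι × (2^ι)ᵒᵈ` with `f₁ = [T][u x][u' y][a(x∪y)]`, `f₂ = [T][a(x∪y)]`, `f₃ = [T][u' y][a]` at the meet,
  `f₄ = [T][u x][a]` at the join: the join `(x ∪ x', y ∩ y')` keeps `x ∈ u` and its union contains `x ∈ u ⊆ a`; the meet
  `(x ∩ x', y ∪ y')` keeps `y ∈ u'` and its union contains `y ∈ u' ⊆ a`.
* COROLLARIES.  `a ≡ ⊤` (`pairCount_and_mul_le`): unconditional negative correlation of `x ∈ u`, `y ∈ u'` for TWO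
  (possibly different) monotone properties and every lattice-closed `T` — for `T = T_∅` and `u = u'` this is the tree's
  `SahiTripartition.triCount_and_mul_le` (gen 17, proved there by FKG), for `T = T_t` it is the degree-1 member
  `M₁² ≥ M₀M₂` of the chain behind `UnateTripartitionULC` for UNATE properties (new in the kernel), for `u ≠ u'` the
  "cross" version (Dubhashi–Ranjan negative association of balls in cells, increasing events of disjoint blocks).
* WHAT THIS DOES NOT GIVE (memo §1–§2, exact censuses).  The degree-2 members of the chain condition on the THIRD cell:
  `Cov(1_u(X),1_u(Y) | Z ∈ u) ≤ 0` (Half A) and `… | Z ∉ u) ≤ 0` (Half B).  Half B conditions on a down-set of `Z`'s but NOT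
  one of the form `{Zᶜ ∈ a}` with `a ⊇ u`; Half A conditions on an up-set.  Both remain OPEN (census-true through 6 points);
  the four-functions hypothesis fails for them on the pair lattice in every assignment of the four functions (memo §2),
  and every polarised ("cross", `u ≠ u'`) form of either half is FALSE (exact counterexamples on 5 points, memo §2) — in
  particular "given `Z ∈ C ⊇ U ∪ U'`" (the up-set mirror of the present theorem) fails at
  `U = ↑ad ∪ ↑ace, U' = ↑bc ∪ ↑ace, C = ↑ab ∪ ↑ac ∪ ↑bc ∪ ↑ad ∪ ↑cd ∪ ↑e` (`11·11 < 1·139`).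
HONEST FRAMING: one inequality (a packaged Ahlswede–Daykin corollary) with its specialisations; the tripartition ULC
lemma itself remains OPEN. [this work]
-/

namespace Summit.CriticalPhenomena.PercolationContinuityZ3.Theorems

namespace SahiTripartition

open Finset

variable {ι : Type*} [Fintype ι] [DecidableEq ι]

/-! ### 1. Admissible pairs of cells and their counts -/

/-- Number of `T`-admissible ordered pairs of cells `(x, y)` passing the Boolean test `P`. [this work] -/
def pairCount (T : Finset ι → Finset ι → Bool) (P : Finset ι → Finset ι → Bool) : ℕ :=
  ∑ x : Finset ι, ∑ y : Finset ι, if T x y = true ∧ P x y = true then 1 else 0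

omit [DecidableEq ι] in
/-- A sum over the pair lattice `2^ι × (2^ι)ᵒᵈ` is a double sum over pairs of finsets. [this work] -/
theorem sum_pairLattice (F : Finset ι → Finset ι → ℕ) :
    ∑ p : Finset ι × (Finset ι)ᵒᵈ, F p.1 (OrderDual.ofDual p.2) = ∑ x : Finset ι, ∑ y : Finset ι, F x y := by
  rw [Fintype.sum_prod_type]
  refine Fintype.sum_congr _ _ fun x => ?_
  exact OrderDual.ofDual.sum_comp (F x)

/-- The TWO-COVER admissibility test of a twist set `t`: `x ∩ y ⊆ t ⊆ x ∪ y` (coordinates outside `t` lie in at most one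
of `x, y` — the third cell takes the rest; coordinates in `t` lie in at least one of `x, y` — they are doubly covered by
the three cells).  `t = ∅`: disjoint pairs = ordered tripartitions. [this work] -/
def twoCover (t : Finset ι) (x y : Finset ι) : Bool := decide (x ∩ y ⊆ t ∧ t ⊆ x ∪ y)

omit [Fintype ι] in
/-- The two-cover test is lattice-closed: preserved by `(x ∪ x', y ∩ y')` and `(x ∩ x', y ∪ y')`. [this work] -/
theorem twoCover_latticeClosed (t : Finset ι) ⦃x y x' y' : Finset ι⦄ (h : twoCover t x y = true)
    (h' : twoCover t x' y' = true) :
    twoCover t (x ∪ x') (y ∩ y') = true ∧ twoCover t (x ∩ x') (y ∪ y') = true := by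
  simp only [twoCover, decide_eq_true_eq] at h h' ⊢
  obtain ⟨h1, h2⟩ := h
  obtain ⟨h1', h2'⟩ := h'
  refine ⟨⟨?_, ?_⟩, ?_, ?_⟩
  · intro j hj
    simp only [mem_inter, mem_union] at hj
    rcases hj.1 with hx | hx
    · exact h1 (mem_inter.mpr ⟨hx, hj.2.1⟩)
    · exact h1' (mem_inter.mpr ⟨hx, hj.2.2⟩)
  · intro j hj
    simp only [mem_union, mem_inter]
    rcases mem_union.mp (h2 hj) with hx | hy
    · exact Or.inl (Or.inl hx)
    · rcases mem_union.mp (h2' hj) with hx' | hy'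
      · exact Or.inl (Or.inr hx')
      · exact Or.inr ⟨hy, hy'⟩
  · intro j hj
    simp only [mem_inter, mem_union] at hj
    rcases hj.2 with hy | hy
    · exact h1 (mem_inter.mpr ⟨hj.1.1, hy⟩)
    · exact h1' (mem_inter.mpr ⟨hj.1.2, hy⟩)
  · intro j hj
    simp only [mem_union, mem_inter]
    rcases mem_union.mp (h2 hj) with hx | hy
    · rcases mem_union.mp (h2' hj) with hx' | hy'
      · exact Or.inl ⟨hx, hx'⟩
      · exact Or.inr (Or.inr hy')
    · exact Or.inr (Or.inl hy)

omit [Fintype ι] in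
/-- For `t = ∅` the two-cover test is disjointness (the pair is two cells of an ordered tripartition). [this work] -/
theorem twoCover_empty (x y : Finset ι) : twoCover ∅ x y = decide (Disjoint x y) := by
  simp only [twoCover, empty_subset, and_true, subset_empty, disjoint_iff_inter_eq_empty]

/-! ### 2. The union-conditioned negative correlation (four functions theorem) -/

/-- **THEOREM (negative correlation of two cells given that their union lies in a common super-up-set).**
For an admissibility test `T` preserved by `(x ∪ x', y ∩ y')` and `(x ∩ x', y ∪ y')`, and monotone Boolean `u, u', a`
with `u ≤ a`, `u' ≤ a`:
`#{x ∈ u, y ∈ u', x ∪ y ∈ a} · #{x ∪ y ∈ a} ≤ #{x ∈ u, x ∪ y ∈ a} · #{y ∈ u', x ∪ y ∈ a}` (admissible pairs).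
Proof: Mathlib's `four_functions_theorem_univ` on `2^ι × (2^ι)ᵒᵈ`. [this work] -/
theorem pairCount_unionCond_mul_le (T : Finset ι → Finset ι → Bool)
    (hT : ∀ ⦃x y x' y' : Finset ι⦄, T x y = true → T x' y' = true →
      T (x ∪ x') (y ∩ y') = true ∧ T (x ∩ x') (y ∪ y') = true)
    (u u' a : Finset ι → Bool) (hu : Monotone u) (hu' : Monotone u') (ha : Monotone a)
    (hua : ∀ x, u x = true → a x = true) (hu'a : ∀ y, u' y = true → a y = true) :
    pairCount T (fun x y => u x && u' y && a (x ∪ y)) * pairCount T (fun x y => a (x ∪ y)) ≤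
      pairCount T (fun x y => u x && a (x ∪ y)) * pairCount T (fun x y => u' y && a (x ∪ y)) := by
  classical
  -- the four functions on the lattice L = Finset ι × (Finset ι)ᵒᵈ
  let L := Finset ι × (Finset ι)ᵒᵈ
  let f₁ : L → ℕ := fun p =>
    if T p.1 (OrderDual.ofDual p.2) = true ∧
      (u p.1 && u' (OrderDual.ofDual p.2) && a (p.1 ∪ OrderDual.ofDual p.2)) = true then 1 else 0
  let f₂ : L → ℕ := fun p =>
    if T p.1 (OrderDual.ofDual p.2) = true ∧ a (p.1 ∪ OrderDual.ofDual p.2) = true then 1 else 0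
  let f₃ : L → ℕ := fun p =>
    if T p.1 (OrderDual.ofDual p.2) = true ∧
      (u' (OrderDual.ofDual p.2) && a (p.1 ∪ OrderDual.ofDual p.2)) = true then 1 else 0
  let f₄ : L → ℕ := fun p =>
    if T p.1 (OrderDual.ofDual p.2) = true ∧ (u p.1 && a (p.1 ∪ OrderDual.ofDual p.2)) = true then 1 else 0
  have h₁ : 0 ≤ f₁ := fun _ => Nat.zero_le _
  have h₂ : 0 ≤ f₂ := fun _ => Nat.zero_le _
  have h₃ : 0 ≤ f₃ := fun _ => Nat.zero_le _
  have h₄ : 0 ≤ f₄ := fun _ => Nat.zero_le _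
  have hAD : ∀ p q : L, f₁ p * f₂ q ≤ f₃ (p ⊓ q) * f₄ (p ⊔ q) := by
    rintro ⟨x, yd⟩ ⟨x', yd'⟩
    have e3 : f₃ ((x, yd) ⊓ (x', yd')) =
        (if T (x ∩ x') (OrderDual.ofDual yd ∪ OrderDual.ofDual yd') = true ∧
          (u' (OrderDual.ofDual yd ∪ OrderDual.ofDual yd') &&
            a ((x ∩ x') ∪ (OrderDual.ofDual yd ∪ OrderDual.ofDual yd'))) = true then 1 else 0) := rfl
    have e4 : f₄ ((x, yd) ⊔ (x', yd')) =
        (if T (x ∪ x') (OrderDual.ofDual yd ∩ OrderDual.ofDual yd') = true ∧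
          (u (x ∪ x') && a ((x ∪ x') ∪ (OrderDual.ofDual yd ∩ OrderDual.ofDual yd'))) = true then 1 else 0) :=
      rfl
    have e1 : f₁ (x, yd) = (if T x (OrderDual.ofDual yd) = true ∧
        (u x && u' (OrderDual.ofDual yd) && a (x ∪ OrderDual.ofDual yd)) = true then 1 else 0) := rfl
    have e2 : f₂ (x', yd') = (if T x' (OrderDual.ofDual yd') = true ∧
        a (x' ∪ OrderDual.ofDual yd') = true then 1 else 0) := rfl
    rw [e1, e2, e3, e4]
    generalize OrderDual.ofDual yd = y
    generalize OrderDual.ofDual yd' = y'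
    by_cases c1 : T x y = true ∧ (u x && u' y && a (x ∪ y)) = true
    · by_cases c2 : T x' y' = true ∧ a (x' ∪ y') = true
      · rw [if_pos c1, if_pos c2]
        obtain ⟨hTxy, hc⟩ := c1
        simp only [Bool.and_eq_true] at hc
        obtain ⟨⟨hux, huy⟩, _⟩ := hc
        obtain ⟨hj, hm⟩ := hT hTxy c2.1
        have g3 : T (x ∩ x') (y ∪ y') = true ∧ (u' (y ∪ y') && a ((x ∩ x') ∪ (y ∪ y'))) = true := by
          refine ⟨hm, ?_⟩
          simp only [Bool.and_eq_true]
          refine ⟨?_, ?_⟩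
          · exact le_antisymm (Bool.le_true _) (huy ▸ hu' (subset_union_left))
          · have hay : a y = true := hu'a y huy
            exact le_antisymm (Bool.le_true _)
              (hay ▸ ha (subset_union_left.trans subset_union_right))
        have g4 : T (x ∪ x') (y ∩ y') = true ∧ (u (x ∪ x') && a ((x ∪ x') ∪ (y ∩ y'))) = true := by
          refine ⟨hj, ?_⟩
          simp only [Bool.and_eq_true]
          refine ⟨?_, ?_⟩
          · exact le_antisymm (Bool.le_true _) (hux ▸ hu (subset_union_left))
          · have hax : a x = true := hua x hux
            exact le_antisymm (Bool.le_true _)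
              (hax ▸ ha (subset_union_left.trans subset_union_left))
        rw [if_pos g3, if_pos g4]
      · rw [if_neg c2, mul_zero]; exact Nat.zero_le _
    · rw [if_neg c1, zero_mul]; exact Nat.zero_le _
  have FFT := four_functions_theorem_univ f₁ f₂ f₃ f₄ h₁ h₂ h₃ h₄ hAD
  -- identify the four sums
  have s1 : ∑ p, f₁ p = pairCount T (fun x y => u x && u' y && a (x ∪ y)) :=
    sum_pairLattice (fun x y => if T x y = true ∧ (u x && u' y && a (x ∪ y)) = true then 1 else 0)
  have s2 : ∑ p, f₂ p = pairCount T (fun x y => a (x ∪ y)) :=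
    sum_pairLattice (fun x y => if T x y = true ∧ a (x ∪ y) = true then 1 else 0)
  have s3 : ∑ p, f₃ p = pairCount T (fun x y => u' y && a (x ∪ y)) :=
    sum_pairLattice (fun x y => if T x y = true ∧ (u' y && a (x ∪ y)) = true then 1 else 0)
  have s4 : ∑ p, f₄ p = pairCount T (fun x y => u x && a (x ∪ y)) :=
    sum_pairLattice (fun x y => if T x y = true ∧ (u x && a (x ∪ y)) = true then 1 else 0)
  rw [s1, s2, s3, s4] at FFT
  rw [mul_comm (pairCount T (fun x y => u x && a (x ∪ y)))]
  exact FFT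

/-- **Unconditional case (`a ≡ ⊤`): two cells are negatively correlated for TWO monotone properties** —
`#{x ∈ u, y ∈ u'} · #{all} ≤ #{x ∈ u} · #{y ∈ u'}` over the `T`-admissible pairs, `T` lattice-closed.  For
`T = twoCover ∅` and `u = u'` this is the tree's `triCount_and_mul_le` (gen 17); for `T = twoCover t` it is the
degree-1 member of the ULC chain for the UNATE property `u (· △ t)`; for `u ≠ u'` the "cross" version
(Dubhashi–Ranjan). [this work] -/
theorem pairCount_and_mul_le (T : Finset ι → Finset ι → Bool)
    (hT : ∀ ⦃x y x' y' : Finset ι⦄, T x y = true → T x' y' = true →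
      T (x ∪ x') (y ∩ y') = true ∧ T (x ∩ x') (y ∪ y') = true)
    (u u' : Finset ι → Bool) (hu : Monotone u) (hu' : Monotone u') :
    pairCount T (fun x y => u x && u' y) * pairCount T (fun _ _ => true) ≤
      pairCount T (fun x _ => u x) * pairCount T (fun _ y => u' y) := by
  have h := pairCount_unionCond_mul_le T hT u u' (fun _ => true) hu hu' (fun _ _ _ => le_rfl)
    (fun _ _ => rfl) (fun _ _ => rfl)
  simp only [Bool.and_true] at h
  exact h

/-- **The two-cover / unate instance.**  For every twist set `t` and monotone `u, u' ≤ a`: over the pairs of cells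
`(x, y)` with `x ∩ y ⊆ t ⊆ x ∪ y` (ordered tripartitions for `t = ∅`), conditioned on `x ∪ y ∈ a`, the events `x ∈ u`
and `y ∈ u'` are negatively correlated. [this work] -/
theorem twoCover_unionCond_mul_le (t : Finset ι) (u u' a : Finset ι → Bool) (hu : Monotone u)
    (hu' : Monotone u') (ha : Monotone a) (hua : ∀ x, u x = true → a x = true)
    (hu'a : ∀ y, u' y = true → a y = true) :
    pairCount (twoCover t) (fun x y => u x && u' y && a (x ∪ y)) * pairCount (twoCover t) (fun x y => a (x ∪ y)) ≤
      pairCount (twoCover t) (fun x y => u x && a (x ∪ y)) *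
        pairCount (twoCover t) (fun x y => u' y && a (x ∪ y)) :=
  pairCount_unionCond_mul_le (twoCover t) (fun _ _ _ _ h h' => twoCover_latticeClosed t h h') u u' a hu hu' ha
    hua hu'a

/-- **Degree-1 member for unate properties (two-cover form).**  For every twist set `t` and monotone `u, u'`:
`#{x ∈ u, y ∈ u'} · #{all} ≤ #{x ∈ u} · #{y ∈ u'}` over the two-covers of `t`; with `u = u'` and the bijection
`(X, Y) ↦ (X △ t, Y △ t)` from ordered tripartitions to two-covers this is `M₁² ≥ M₀M₂` for the unate property
`X ↦ u (X △ t)` (memo §1). [this work] -/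
theorem twoCover_and_mul_le (t : Finset ι) (u u' : Finset ι → Bool) (hu : Monotone u) (hu' : Monotone u') :
    pairCount (twoCover t) (fun x y => u x && u' y) * pairCount (twoCover t) (fun _ _ => true) ≤
      pairCount (twoCover t) (fun x _ => u x) * pairCount (twoCover t) (fun _ y => u' y) :=
  pairCount_and_mul_le (twoCover t) (fun _ _ _ _ h h' => twoCover_latticeClosed t h h') u u' hu hu'

end SahiTripartition

end Summit.CriticalPhenomena.PercolationContinuityZ3.Theorems
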